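import Mathlib
import Summits.CriticalPhenomena.CardyFormulaZ2.Theorems.CardyMagicRigidityDefs
import Summits.CriticalPhenomena.CardyFormulaZ2.Theorems.CardyMagicRigidityNestingRigidityDomainEnsembleSupport
import Summits.CriticalPhenomena.CardyFormulaZ2.Theorems.CardyMagicRigidityNestingRigidityStaircaseCloud
import Literature.Probability.Percolation.AnnulusCrossingBoundProofs
import Literature.Probability.Percolation.TriAnnulusCrossingProofs
import Literature.Probability.Percolation.MacroscopicInterfaceLoop
import Literature.Probability.Percolation.QuadCrossingMeasurability
import Literature.Probability.Percolation.NestingWeightMeasurable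
import Literature.Probability.Percolation.FullPlaneCNLProofs
import HarnessLib

/-!
# Crux `NestingRigidity`, line `ring-cloud-tomography` (r4): gap-crossing loops are rare
# (the RSW input (G) of stub R2' `stub_staircaseDecoupling`, on BOTH lattices)

Crux `Summit.CriticalPhenomena.CardyFormulaZ2.Theses.CardyMagicRigidity.NestingRigidity`
(stmt-CriticalPhenomena-4835), line `ring-cloud-tomography`, skeleton r4, stub R2'
`stub_staircaseDecoupling`.  The landed bite classification of the staircase cloud
(`Staircase.nestingFactor_nonneg_or_cross`, `…StaircaseCloud`) says that a loop with a NEGATIVE weight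
for the staircase density has a trace meeting both `B̄(0, M j₁)` and `ℂ ∖ B(0, L j₂)` for some
`j₁ < j₂`: it crosses the gap annulus `A(0; M j₁, L j₂)`.  This file proves that such loops are RARE,
uniformly in the mesh, on both lattice ensembles of the crux:

* §1 **bond-`ℤ²` dictionary (loop ⇒ open arm).**  An interface loop of `ω` drawn at mesh `δ` whose
  trace meets `B̄(x, a)` and `ℂ ∖ B(x, b)` (`a + 2δ ≤ b`) puts `ω` in the tree's event
  `annulusOpenCrossing x δ (a + δ) (b − δ)` (`AnnulusCrossingBound.lean`): every trace point is within
  `δ/2` of the left (open-side) vertex of a dart (`exists_left_dist_le_mesh`), the left vertices of an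
  interface loop are chained by open lattice edges (`IsInterfaceLoop.reachable_left`, the rim), and an
  open lattice walk from inside `B̄(x, a + δ/2)` to outside `B(x, b − δ/2)` contains a confined crossing
  (stop at the first exit, `GapCrossing.exists_exit_openConnIn`).
* §2 **site-`𝕋` dictionary.**  The same with the open left sites `lv i` of a honeycomb interface loop
  (`IsSiteInterfaceLoop.pathIn_lv`, `polyPiece_subset_closedBall`): the loop puts `ω` in
  `triAnnulusCrossing true δ x (a + 2δ) (b − 2δ)` (`TriAnnulusCrossing.lean`).
* §3 **the probability bound** (registered anchor `measure_exists_loop_cross_le_latticeEnsembles`):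
  for `E ∈ latticeEnsembles` there are `c, C, c₀ > 0` with
  `E.P {some loop of X_δ meets B̄(x,a) and ℂ ∖ B(x,b)} ≤ C (a/b)^c` whenever `0 < δ`, `c₀ δ ≤ a`,
  `0 < b` — from the PROVED RSW annulus bounds of the tree (`annulusOpenCrossing_half_le_holds`,
  Grimmett 1999 §11.8; `tri_annulusCrossing_bound_holds`, Bollobás–Riordan 2006 Ch. 7 Lemma 4).  No
  measurability of the loop event is needed (outer measure monotonicity into the crossing event).
* §4 **signed staircase loops are rare**: combining §3 with the classification, the probability that
  some loop of `X_δ` has a negative nesting factor for the staircase cloud is at most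
  `∑_{j₁ < j₂} C (M j₁ / L j₂)^c` for all small `δ`, an `r`-independent quantity made small by wide
  gaps.

What remains of R2' after this file: (Q) the positivity/quasi-multiplicativity pairing of the
almost-positive outer factor with non-negative inner functionals and (U) the UV-drift concentration
with the first-moment identity (as in R1').
-/

noncomputable section

open MeasureTheory Set Filter Metric
open scoped Real Topology BigOperators ENNReal

namespace Summit.CriticalPhenomena.CardyFormulaZ2.Cruxes.NestingRigidity.RingCloudTomography

open Literature.Probability.RandomPlanarGeometry Literature.Probability.Percolation
  Literature.Probability.LatticeModels
open Summit.CriticalPhenomena.CardyFormulaZ2.Cruxes.NestingRigidity.MarkovCascadeOneGeneration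
  (exists_left_dist_le_mesh)

namespace GapCrossing

/-! ## §1 Bond-`ℤ²`: a gap-crossing interface loop gives a confined open crossing -/

/-- **First exit of an open lattice walk.**  A walk of open lattice edges of `ω` (mesh `δ ≥ 0`) from
a site drawn inside `B(x, R)` to a site drawn outside it reaches some site `w` at distance `≥ R` from
`x` through sites all within `R + 2δ` of `x`: stop at the first vertex outside `B(x, R)` (it is one
lattice step, `≤ δ`, from a vertex inside). -/
theorem exists_exit_openConnIn {ω : BondConfig (Site 2)} {δ : ℝ} (hδ : 0 ≤ δ) (x : ℂ) (R : ℝ)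
    {u v : Site 2} (W : (openGraph ω ⊓ zdGraph 2).Walk u v) (hu : dist (meshPoint δ u) x < R)
    (hv : R ≤ dist (meshPoint δ v) x) :
    ∃ w : Site 2, R ≤ dist (meshPoint δ w) x ∧
      ω ∈ openConnIn {s | dist (meshPoint δ s) x ≤ R + 2 * δ} u w := by
  induction W with
  | nil => exact absurd hv (not_le.2 hu)
  | @cons p q _ hadj W ih =>
    have hadj' := (SimpleGraph.inf_adj _ _ _ _).1 hadj
    have hopen : s(p, q) ∈ ω := ((openGraph_adj _ _ _).1 hadj'.1).1
    have hne : p ≠ q := hadj'.2.ne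
    have hstep : dist (meshPoint δ q) x ≤ dist (meshPoint δ p) x + δ := by
      have h1 := norm_meshPoint_sub_meshPoint_le_of_adj δ hadj'.2
      rw [abs_of_nonneg hδ, ← dist_eq_norm] at h1
      linarith [dist_triangle (meshPoint δ q) (meshPoint δ p) x]
    have hpS : p ∈ {s : Site 2 | dist (meshPoint δ s) x ≤ R + 2 * δ} := by
      show dist (meshPoint δ p) x ≤ R + 2 * δ
      linarith
    by_cases hq : R ≤ dist (meshPoint δ q) x
    · refine ⟨q, hq, openConnIn_of_adj hpS ?_ hopen hne⟩
      show dist (meshPoint δ q) x ≤ R + 2 * δ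
      linarith
    · obtain ⟨w, hw, hconn⟩ := ih (not_le.1 hq) hv
      have hqS : q ∈ {s : Site 2 | dist (meshPoint δ s) x ≤ R + 2 * δ} := by
        obtain ⟨hqS, -, -⟩ := hconn
        exact hqS
      exact ⟨w, hw, PlanarDuality.openConnIn_trans (openConnIn_of_adj hpS hqS hopen hne) hconn⟩

/-- **Loop ⇒ open arm on `δℤ²`.**  If an interface loop of `ω`, drawn at mesh `δ > 0`, has a trace
point within `a` of `x` and a trace point at distance `≥ b` from `x`, with `a + 2δ ≤ b`, then
`ω ∈ annulusOpenCrossing x δ (a + δ) (b − δ)`: the left vertices of the darts through the two points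
are within `δ/2` of them (`exists_left_dist_le_mesh`) and are joined by open lattice edges (the rim,
`IsInterfaceLoop.reachable_left`), a walk which is stopped at its first exit from `B(x, b − δ)`. -/
theorem mem_annulusOpenCrossing_of_isInterfaceLoop {ω : BondConfig (Site 2)} {γ : List MedialVertex}
    (h : IsInterfaceLoop ω γ) {δ : ℝ} (hδ : 0 < δ) (x : ℂ) {a b : ℝ} (hab : a + 2 * δ ≤ b)
    {z z' : ℂ} (hz : z ∈ (loopCurve δ 0 γ).range) (hz' : z' ∈ (loopCurve δ 0 γ).range)
    (hza : dist z x ≤ a) (hz'b : b ≤ dist z' x) :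
    ω ∈ annulusOpenCrossing x δ (a + δ) (b - δ) := by
  obtain ⟨p, hp, hpz⟩ := exists_left_dist_le_mesh h δ hz
  obtain ⟨q, hq, hqz⟩ := exists_left_dist_le_mesh h δ hz'
  rw [abs_of_pos hδ] at hpz hqz
  have hpa : dist (meshPoint δ p.1) x ≤ a + δ / 2 := by
    linarith [dist_triangle (meshPoint δ p.1) z x, dist_comm z (meshPoint δ p.1)]
  have hqb : b - δ / 2 ≤ dist (meshPoint δ q.1) x := by
    linarith [dist_triangle z' (meshPoint δ q.1) x]
  obtain ⟨W⟩ := h.reachable_left hp hq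
  obtain ⟨w, hw, hconn⟩ := exists_exit_openConnIn hδ.le x (b - δ) W (by linarith) (by linarith)
  exact mem_annulusOpenCrossing_iff.2 ⟨p.1, by linarith, w, hw, hconn⟩

/-- **The gap-crossing event of `zEns` lies in the open annulus crossing**: if some loop of
`X_δ(ω) = bondLoopConfig δ 0 ω` meets `B̄(x, a)` and `ℂ ∖ B(x, b)` (`a + 2δ ≤ b`, `δ > 0`), then
`ω ∈ annulusOpenCrossing x δ (a + δ) (b − δ)`. -/
theorem setOf_loop_cross_subset_annulusOpenCrossing {δ : ℝ} (hδ : 0 < δ) (x : ℂ) {a b : ℝ}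
    (hab : a + 2 * δ ≤ b) :
    {ω | ∃ u ∈ (zEns.X δ ω).loops, (u.range ∩ closedBall x a).Nonempty ∧
        (u.range ∩ (ball x b)ᶜ).Nonempty} ⊆ annulusOpenCrossing x δ (a + δ) (b - δ) := by
  rintro ω ⟨u, hu, ⟨z, hzu, hza⟩, ⟨z', hz'u, hz'b⟩⟩
  obtain ⟨⟨γ, hne⟩, h, rfl⟩ := (mem_loops_iff δ ω u).1 hu
  exact mem_annulusOpenCrossing_of_isInterfaceLoop h hδ x hab hzu hz'u (mem_closedBall.1 hza)
    (not_lt.1 hz'b)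

/-- **Gap-crossing loops of `zEns` are rare** (RSW, Grimmett 1999 §11.8 via the tree's proved
`annulusOpenCrossing_half_le_holds`): there are `c, C, c₀ > 0` such that for every centre `x`, mesh
`δ > 0` and radii with `c₀ δ ≤ a`, `0 < b`, the probability that some loop of `X_δ` meets both
`B̄(x, a)` and `ℂ ∖ B(x, b)` is at most `C (a/b)^c`. -/
theorem measure_loop_cross_le_zEns : ∃ c C c₀ : ℝ, 0 < c ∧ 0 < C ∧ 0 < c₀ ∧
    ∀ (x : ℂ) (a b δ : ℝ), 0 < δ → c₀ * δ ≤ a → 0 < b →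
      zEns.P {ω | ∃ u ∈ (zEns.X δ ω).loops, (u.range ∩ closedBall x a).Nonempty ∧
        (u.range ∩ (ball x b)ᶜ).Nonempty} ≤ ENNReal.ofReal (C * (a / b) ^ c) := by
  haveI : IsProbabilityMeasure zEns.P :=
    inferInstanceAs (IsProbabilityMeasure (bondPercolation (zdGraph 2) half))
  obtain ⟨α, c₀, hα, hc₀, hbd⟩ := annulusOpenCrossing_half_le_holds
  refine ⟨α, 4 ^ α, max c₀ 2, hα, by positivity, by positivity, fun x a b δ hδ ha hb0 ↦ ?_⟩
  have hδa : 2 * δ ≤ a := le_trans (mul_le_mul_of_nonneg_right (le_max_right c₀ 2) hδ.le) ha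
  have hc₀a : c₀ * δ ≤ a := le_trans (mul_le_mul_of_nonneg_right (le_max_left c₀ 2) hδ.le) ha
  have ha0 : 0 < a := by linarith
  have hab0 : 0 ≤ a / b := div_nonneg ha0.le hb0.le
  by_cases h4 : 4 * a ≤ b
  · have hsub := setOf_loop_cross_subset_annulusOpenCrossing hδ x (a := a) (b := b) (by linarith)
    have hratio : (a + δ) / (b - δ) ≤ 4 * (a / b) := by
      rw [mul_div_assoc', div_le_div_iff₀ (by linarith) hb0]
      nlinarith
    calc zEns.P {ω | ∃ u ∈ (zEns.X δ ω).loops, (u.range ∩ closedBall x a).Nonempty ∧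
          (u.range ∩ (ball x b)ᶜ).Nonempty}
        ≤ zEns.P (annulusOpenCrossing x δ (a + δ) (b - δ)) := measure_mono hsub
      _ = ENNReal.ofReal ((bondPercolation (zdGraph 2) half).real
            (annulusOpenCrossing x δ (a + δ) (b - δ))) :=
          (ENNReal.ofReal_toReal (measure_ne_top _ _)).symm
      _ ≤ ENNReal.ofReal (((a + δ) / (b - δ)) ^ α) :=
          ENNReal.ofReal_le_ofReal (hbd x δ (a + δ) (b - δ) hδ (by linarith) (by linarith))
      _ ≤ ENNReal.ofReal (4 ^ α * (a / b) ^ α) := by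
          refine ENNReal.ofReal_le_ofReal ?_
          rw [← Real.mul_rpow (by norm_num) hab0]
          exact Real.rpow_le_rpow (div_nonneg (by linarith) (by linarith)) hratio hα.le
  · have h1 : (1 : ℝ) ≤ 4 ^ α * (a / b) ^ α := by
      rw [← Real.mul_rpow (by norm_num) hab0]
      refine Real.one_le_rpow ?_ hα.le
      rw [mul_div_assoc', le_div_iff₀ hb0]
      linarith
    calc zEns.P _ ≤ 1 := prob_le_one
      _ = ENNReal.ofReal 1 := ENNReal.ofReal_one.symm
      _ ≤ _ := ENNReal.ofReal_le_ofReal h1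

/-! ## §2 Site-`𝕋`: a gap-crossing honeycomb interface loop gives an open crossing -/

/-- **Loop ⇒ open arm on `δ𝕋`.**  If a honeycomb interface loop of `ω` drawn at mesh `δ > 0` has a
trace point within `a` of `x` and one at distance `≥ b` from `x`, then
`ω ∈ triAnnulusCrossing true δ x (a + 2δ) (b − 2δ)`: the open left sites of the darts through the two
points are within `δ` of them (`polyPiece_subset_closedBall`) and all left sites are chained by open
sites (`IsSiteInterfaceLoop.pathIn_lv`). -/
theorem mem_triAnnulusCrossing_of_isSiteInterfaceLoop {ω : SiteConfig (Site 2)} {F : HexVertex}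
    {γ : hexGraph.Walk F F} (hγ : IsSiteInterfaceLoop ω γ) {δ : ℝ} (hδ : 0 < δ) (x : ℂ) {a b : ℝ}
    {z z' : ℂ} (hz : z ∈ polyTrace δ γ) (hz' : z' ∈ polyTrace δ γ) (hza : dist z x ≤ a)
    (hz'b : b ≤ dist z' x) :
    ω ∈ triAnnulusCrossing true δ x (a + 2 * δ) (b - 2 * δ) := by
  obtain ⟨i, hi, hzi⟩ := mem_polyTrace_iff.1 hz
  obtain ⟨i', hi', hzi'⟩ := mem_polyTrace_iff.1 hz'
  have h1 : dist z (triMeshPoint δ (hγ.lv i)) ≤ δ := hγ.polyPiece_subset_closedBall hδ.le hi hzi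
  have h2 : dist z' (triMeshPoint δ (hγ.lv i')) ≤ δ := hγ.polyPiece_subset_closedBall hδ.le hi' hzi'
  have hpath : PathIn triGraph ω (hγ.lv i) (hγ.lv i') :=
    (hγ.pathIn_lv hi).symm.trans (hγ.pathIn_lv hi')
  obtain ⟨W, hW⟩ := hpath.exists_walk
  refine ⟨hγ.lv i, hγ.lv i', W, ?_, ?_, fun v hv ↦ ⟨fun _ ↦ rfl, fun _ ↦ hW v hv⟩⟩
  · rw [← dist_eq_norm]
    linarith [dist_triangle (triMeshPoint δ (hγ.lv i)) z x, dist_comm z (triMeshPoint δ (hγ.lv i))]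
  · rw [← dist_eq_norm]
    linarith [dist_triangle z' (triMeshPoint δ (hγ.lv i')) x]

/-- **The gap-crossing event of `tEns` lies in the open annulus crossing of `δ𝕋`**: if some loop of
`X_δ(ω) = siteLoopConfig δ ω` meets `B̄(x, a)` and `ℂ ∖ B(x, b)` (`δ > 0`), then
`ω ∈ triAnnulusCrossing true δ x (a + 2δ) (b − 2δ)`. -/
theorem setOf_loop_cross_subset_triAnnulusCrossing {δ : ℝ} (hδ : 0 < δ) (x : ℂ) (a b : ℝ) :
    {ω | ∃ u ∈ (tEns.X δ ω).loops, (u.range ∩ closedBall x a).Nonempty ∧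
        (u.range ∩ (ball x b)ᶜ).Nonempty} ⊆ triAnnulusCrossing true δ x (a + 2 * δ) (b - 2 * δ) := by
  rintro ω ⟨u, hu, ⟨z, hzu, hza⟩, ⟨z', hz'u, hz'b⟩⟩
  obtain ⟨⟨F, γ⟩, hγ, rfl⟩ := (mem_loops_siteLoopConfig_iff δ ω u).1 hu
  have hγ' : IsSiteInterfaceLoop ω γ := hγ
  have hr : (UnbasedLoop.mk (BasedLoop.mk (siteLoopCurve δ γ) (isLoop_siteLoopCurve δ γ))).range =
      polyTrace δ γ := by
    rw [range_mk_siteLoopCurve]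
    exact range_toCurve_eq_polyTrace (by have := hγ'.isCycle.three_le_length; omega)
  simp only at hzu hz'u
  rw [hr] at hzu hz'u
  exact mem_triAnnulusCrossing_of_isSiteInterfaceLoop hγ' hδ x hzu hz'u (mem_closedBall.1 hza)
    (not_lt.1 hz'b)

/-- **Gap-crossing loops of `tEns` are rare** (Bollobás–Riordan 2006, Ch. 7 Lemma 4, via the tree's
proved `tri_annulusCrossing_bound_holds`): there are `c, C, c₀ > 0` such that for every centre `x`,
mesh `δ > 0` and radii with `c₀ δ ≤ a`, `0 < b`, the probability that some loop of `X_δ` meets both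
`B̄(x, a)` and `ℂ ∖ B(x, b)` is at most `C (a/b)^c`. -/
theorem measure_loop_cross_le_tEns : ∃ c C c₀ : ℝ, 0 < c ∧ 0 < C ∧ 0 < c₀ ∧
    ∀ (x : ℂ) (a b δ : ℝ), 0 < δ → c₀ * δ ≤ a → 0 < b →
      tEns.P {ω | ∃ u ∈ (tEns.X δ ω).loops, (u.range ∩ closedBall x a).Nonempty ∧
        (u.range ∩ (ball x b)ᶜ).Nonempty} ≤ ENNReal.ofReal (C * (a / b) ^ c) := by
  haveI : IsProbabilityMeasure tEns.P :=
    inferInstanceAs (IsProbabilityMeasure (triSitePercolation half))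
  obtain ⟨α, hα, hbd⟩ := tri_annulusCrossing_bound_holds
  refine ⟨α, 4 ^ α, 1000, hα, by positivity, by norm_num, fun x a b δ hδ ha hb0 ↦ ?_⟩
  have ha0 : 0 < a := by linarith
  have hab0 : 0 ≤ a / b := div_nonneg ha0.le hb0.le
  by_cases h4 : 4 * a ≤ b
  · have hsub := setOf_loop_cross_subset_triAnnulusCrossing hδ x a b
    have hratio : (a + 2 * δ) / (b - 2 * δ) ≤ 4 * (a / b) := by
      rw [mul_div_assoc', div_le_div_iff₀ (by linarith) hb0]
      nlinarith
    calc tEns.P {ω | ∃ u ∈ (tEns.X δ ω).loops, (u.range ∩ closedBall x a).Nonempty ∧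
          (u.range ∩ (ball x b)ᶜ).Nonempty}
        ≤ tEns.P (triAnnulusCrossing true δ x (a + 2 * δ) (b - 2 * δ)) := measure_mono hsub
      _ = ENNReal.ofReal ((triSitePercolation half).real
            (triAnnulusCrossing true δ x (a + 2 * δ) (b - 2 * δ))) :=
          (ENNReal.ofReal_toReal (measure_ne_top _ _)).symm
      _ ≤ ENNReal.ofReal (((a + 2 * δ) / (b - 2 * δ)) ^ α) :=
          ENNReal.ofReal_le_ofReal (hbd true δ x (a + 2 * δ) (b - 2 * δ) hδ (by linarith)
            (by linarith))
      _ ≤ ENNReal.ofReal (4 ^ α * (a / b) ^ α) := by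
          refine ENNReal.ofReal_le_ofReal ?_
          rw [← Real.mul_rpow (by norm_num) hab0]
          exact Real.rpow_le_rpow (div_nonneg (by linarith) (by linarith)) hratio hα.le
  · have h1 : (1 : ℝ) ≤ 4 ^ α * (a / b) ^ α := by
      rw [← Real.mul_rpow (by norm_num) hab0]
      refine Real.one_le_rpow ?_ hα.le
      rw [mul_div_assoc', le_div_iff₀ hb0]
      linarith
    calc tEns.P _ ≤ 1 := prob_le_one
      _ = ENNReal.ofReal 1 := ENNReal.ofReal_one.symm
      _ ≤ _ := ENNReal.ofReal_le_ofReal h1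

end GapCrossing

/-! ## §3 Both lattice ensembles (registered anchor) -/

/-- **Gap-crossing loops are rare on both lattice ensembles** (registered helper toward stub R2'
`stub_staircaseDecoupling`, line `ring-cloud-tomography` r4; input (G) of the staircase decoupling).
For `E ∈ latticeEnsembles` there are constants `c, C, c₀ > 0` such that for every centre `x : ℂ`,
every mesh `δ > 0` and all radii `a, b` with `c₀ δ ≤ a` and `0 < b`,
`E.P {ω | some loop of X_δ(ω) meets B̄(x, a) and ℂ ∖ B(x, b)} ≤ C (a / b)^c`:
an interface loop across the annulus carries an open arm on its left (§1 on `δℤ²`, §2 on `δ𝕋`), an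
event of polynomially small probability by the tree's PROVED RSW annulus bounds
(`annulusOpenCrossing_half_le_holds`, `tri_annulusCrossing_bound_holds`).  The loop event need not be
measurable (outer measure). -/
theorem measure_exists_loop_cross_le_latticeEnsembles : ∀ E ∈ latticeEnsembles, ∃ c C c₀ : ℝ,
    0 < c ∧ 0 < C ∧ 0 < c₀ ∧ ∀ (x : ℂ) (a b δ : ℝ), 0 < δ → c₀ * δ ≤ a → 0 < b →
      E.P {ω | ∃ u ∈ (E.X δ ω).loops, (u.range ∩ Metric.closedBall x a).Nonempty ∧
        (u.range ∩ (Metric.ball x b)ᶜ).Nonempty} ≤ ENNReal.ofReal (C * (a / b) ^ c) := by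
  intro E hE
  simp only [latticeEnsembles, Set.mem_insert_iff, Set.mem_singleton_iff] at hE
  rcases hE with rfl | rfl
  · exact GapCrossing.measure_loop_cross_le_zEns
  · exact GapCrossing.measure_loop_cross_le_tEns

/-! ## §4 Signed staircase loops are rare -/

namespace Staircase

/-- **The signed loops of a staircase cloud live on a gap-crossing event of small probability.**  For
`E ∈ latticeEnsembles` take the constants `c, C, c₀` of `measure_exists_loop_cross_le_latticeEnsembles`.
For the staircase cloud with bump charge `t ∈ [−5π/6, 0]` on `B(0, r)` and `k` rings
`L j ≤ ‖z‖ < M j` of charge `−t/k` each (`−t ≤ kπ/6`, `0 < r ≤ L j`, `0 < L j < M j`), at every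
mesh `δ > 0` with `c₀ δ ≤ M j` for all `j`, the probability that SOME loop of `X_δ` has a negative
nesting factor is at most `∑_{j₁ < j₂} C (M j₁ / L j₂)^c`: by the landed classification
(`staircase_nestingFactor_nonneg_or_cross`) such a loop meets `B̄(0, M j₁)` and `ℂ ∖ B(0, L j₂)` for
some `j₁ < j₂`, and each of these gap crossings is rare (§3).  The bound is independent of `r` and
`δ`. -/
theorem measure_exists_nestingFactor_neg_le : ∀ E ∈ latticeEnsembles, ∃ c C c₀ : ℝ,
    0 < c ∧ 0 < C ∧ 0 < c₀ ∧ ∀ (t r : ℝ) (k : ℕ) (L M : Fin k → ℝ),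
      t ∈ Set.Icc (-(5 * π / 6)) 0 → -t ≤ k * (π / 6) → 0 < r → (∀ j, r ≤ L j) →
      (∀ j, 0 < L j) → (∀ j, L j < M j) → ∀ δ : ℝ, 0 < δ → (∀ j, c₀ * δ ≤ M j) →
        E.P {ω | ∃ u ∈ (E.X δ ω).loops,
          u.nestingFactor (Cloud.mk 1 k (fun _ ↦ 0) (fun _ ↦ r) (fun _ ↦ t) (fun _ ↦ 0) L M
            (fun _ ↦ -t / k)).density < 0} ≤
          ∑ j₁, ∑ j₂ ∈ Finset.Ioi j₁, ENNReal.ofReal (C * (M j₁ / L j₂) ^ c) := by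
  intro E hE
  obtain ⟨c, C, c₀, hc, hC, hc₀, hbd⟩ := measure_exists_loop_cross_le_latticeEnsembles E hE
  refine ⟨c, C, c₀, hc, hC, hc₀, fun t r k L M ht htk hr hrL hL hLM δ hδ hδM ↦ ?_⟩
  -- the signed loops cross a gap annulus `A(0; M j₁, L j₂)`, `j₁ < j₂`
  have hsub : {ω | ∃ u ∈ (E.X δ ω).loops,
      u.nestingFactor (Cloud.mk 1 k (fun _ ↦ 0) (fun _ ↦ r) (fun _ ↦ t) (fun _ ↦ 0) L M
        (fun _ ↦ -t / k)).density < 0} ⊆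
      ⋃ j₁ : Fin k, ⋃ j₂ ∈ Finset.Ioi j₁, {ω | ∃ u ∈ (E.X δ ω).loops,
        (u.range ∩ closedBall (0 : ℂ) (M j₁)).Nonempty ∧
          (u.range ∩ (ball (0 : ℂ) (L j₂))ᶜ).Nonempty} := by
    rintro ω ⟨u, hu, hneg⟩
    rcases staircase_nestingFactor_nonneg_or_cross t r k L M ht htk hr hrL hL hLM u with h0 | h0
    · exact absurd hneg (not_lt.2 h0)
    · obtain ⟨j₁, j₂, hj, h₁, h₂⟩ := h0
      simp only [Set.mem_iUnion, Finset.mem_Ioi, exists_prop]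
      exact ⟨j₁, j₂, hj, u, hu, h₁, h₂⟩
  calc E.P {ω | ∃ u ∈ (E.X δ ω).loops,
        u.nestingFactor (Cloud.mk 1 k (fun _ ↦ 0) (fun _ ↦ r) (fun _ ↦ t) (fun _ ↦ 0) L M
          (fun _ ↦ -t / k)).density < 0}
      ≤ E.P (⋃ j₁ : Fin k, ⋃ j₂ ∈ Finset.Ioi j₁, {ω | ∃ u ∈ (E.X δ ω).loops,
          (u.range ∩ closedBall (0 : ℂ) (M j₁)).Nonempty ∧
            (u.range ∩ (ball (0 : ℂ) (L j₂))ᶜ).Nonempty}) := measure_mono hsub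
    _ ≤ ∑ j₁, E.P (⋃ j₂ ∈ Finset.Ioi j₁, {ω | ∃ u ∈ (E.X δ ω).loops,
          (u.range ∩ closedBall (0 : ℂ) (M j₁)).Nonempty ∧
            (u.range ∩ (ball (0 : ℂ) (L j₂))ᶜ).Nonempty}) := measure_iUnion_fintype_le _ _
    _ ≤ ∑ j₁, ∑ j₂ ∈ Finset.Ioi j₁, E.P {ω | ∃ u ∈ (E.X δ ω).loops,
          (u.range ∩ closedBall (0 : ℂ) (M j₁)).Nonempty ∧
            (u.range ∩ (ball (0 : ℂ) (L j₂))ᶜ).Nonempty} :=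
        Finset.sum_le_sum fun j₁ _ ↦ measure_biUnion_finset_le _ _
    _ ≤ ∑ j₁, ∑ j₂ ∈ Finset.Ioi j₁, ENNReal.ofReal (C * (M j₁ / L j₂) ^ c) :=
        Finset.sum_le_sum fun j₁ _ ↦ Finset.sum_le_sum fun j₂ _ ↦
          hbd 0 (M j₁) (L j₂) δ hδ (hδM j₁) (hL j₂)

/-- **Eventual form** (the shape consumed by the decoupling argument): for a FIXED staircase the
lattice threshold `c₀ δ ≤ M j` holds for all small meshes, so for all small `δ > 0` the probability that
some loop of `X_δ` carries a negative staircase weight is at most the `r`- and `δ`-independent constant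
`∑_{j₁ < j₂} C (M j₁ / L j₂)^c`, small when the gaps `A(0; M j₁, L j₂)` are wide. -/
theorem eventually_measure_exists_nestingFactor_neg_le : ∀ E ∈ latticeEnsembles, ∃ c C : ℝ,
    0 < c ∧ 0 < C ∧ ∀ (t r : ℝ) (k : ℕ) (L M : Fin k → ℝ),
      t ∈ Set.Icc (-(5 * π / 6)) 0 → -t ≤ k * (π / 6) → 0 < r → (∀ j, r ≤ L j) →
      (∀ j, 0 < L j) → (∀ j, L j < M j) → ∀ᶠ δ in 𝓝[>] (0 : ℝ),
        E.P {ω | ∃ u ∈ (E.X δ ω).loops,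
          u.nestingFactor (Cloud.mk 1 k (fun _ ↦ 0) (fun _ ↦ r) (fun _ ↦ t) (fun _ ↦ 0) L M
            (fun _ ↦ -t / k)).density < 0} ≤
          ∑ j₁, ∑ j₂ ∈ Finset.Ioi j₁, ENNReal.ofReal (C * (M j₁ / L j₂) ^ c) := by
  intro E hE
  obtain ⟨c, C, c₀, hc, hC, hc₀, hbd⟩ := measure_exists_nestingFactor_neg_le E hE
  refine ⟨c, C, hc, hC, fun t r k L M ht htk hr hrL hL hLM ↦ ?_⟩
  -- the threshold holds eventually, ring by ring
  have hthr : ∀ j, ∀ᶠ δ in 𝓝[>] (0 : ℝ), c₀ * δ ≤ M j := fun j ↦ by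
    have hMj : 0 < M j / c₀ := div_pos ((hL j).trans (hLM j)) hc₀
    filter_upwards [Ioo_mem_nhdsGT hMj] with δ hδ'
    have := (lt_div_iff₀ hc₀).1 hδ'.2
    linarith
  filter_upwards [self_mem_nhdsWithin, Filter.eventually_all.2 hthr] with δ hδ hδM
  exact hbd t r k L M ht htk hr hrL hL hLM δ hδ hδM

end Staircase

end Summit.CriticalPhenomena.CardyFormulaZ2.Cruxes.NestingRigidity.RingCloudTomography

end
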